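import Summits.QuantumFields.YangMills.Cruxes.FibreContinuity.Lines.birth
import Summits.QuantumFields.YangMills.Theorems.FibreContinuity.Negative.SchemaNotBookkeeping

/-!
# Strategy census r1 (redirect) for crux `FibreContinuity` (stmt-QuantumFields-16242) — Lean companion

Strategist `planner-cstrat-stmt-QuantumFields-16242-r1-0`, 2026-08-17, route
`route-QuantumFields-ContractibleFibre`. Companion of `STRATEGY-CENSUS-r1.md` (same directory).
Nothing here asserts a statement of the route; every theorem is closed (no `sorry`).

What is recorded, kernel-checked:

1. `FreeWeakCouplingGap` — the crux's conclusion with its hypothesis DELETED: for every compact simple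
   `G` and faithful unitary `r`, ONE `β₁` and, for `β ≥ β₁`, ONE rate `m(β) > 0` with width-uniform
   constants clustering the free tubes `(ℤ/L)²×{0..M}²` of EVERY width (`Birth.UniformWidthGap`, whose
   body is verbatim the consequent of the route decl). This is the volume-uniform WEAK-COUPLING LATTICE
   MASS GAP of Wilson's `G`-theory with free boundary conditions in two directions — the free-b.c.
   clothing of the route's own target `UniformLatticeGap` (stmt-QuantumFields-8778, Chatterjee's
   Problem 5.1 first half, `Literature.MathematicalPhysics.QuantumFieldTheory.LatticeMassGapAllCouplings`).
2. `fibreContinuity_iff_freeGap` — GIVEN the route's rank-3 crux `FibreAnchor` (which the route must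
   prove anyway, and whose `M = 0` member `PlanarAnchor` is proved), the crux `FibreContinuity` is
   EQUIVALENT to `FreeWeakCouplingGap`: the anchor hypothesis is logically idle. Unconditionally,
   `FreeWeakCouplingGap → FibreContinuity` (`fibreContinuity_of_freeGap`).
3. `freeGap_anchorShape` — the conclusion dominates the hypothesis in kind: `FreeWeakCouplingGap` returns
   the anchor SHAPE with `β`-dependent rates beyond `β₁` (bookkeeping, via the landed negative-lane lemma
   `Negative.uniformShape_anchorShape`); it does not return the anchor's `β`-UNIFORM rates, which is why
   `FibreAnchor` stays a side hypothesis in item 2.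
4. The torus-conditional decomposition (census heading Decomposition, D4) typed and shown CIRCULAR:
   `TorusGapAll` (= `UniformLatticeGap`, `torusGapAll_iff`) and `TorusToTube` (torus gap ⇒ free tubes,
   the free-end-transfer-flow idea read as a split) give the crux (`fibreContinuity_of_torusSplit`), but
   the piece `TorusGapAll` together with the route's rank-5 leg ALREADY proves the summit
   (`yangMills_of_torusGapAll_of_leg`) — under this split `FibreAnchor`, `FibreContinuity`,
   `FibreToTorus` and `TorusToTube` leave the cone of `closes`: not a redirect of the crux but a
   retirement of the route's own content (BC6 / hidden-summit check (ii)).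
-/

set_option autoImplicit false

noncomputable section

namespace Summit.QuantumFields.YangMills.Cruxes.FibreContinuity.CensusR1

open MeasureTheory
open Literature.MathematicalPhysics.QuantumFieldTheory
open Summit.QuantumFields.YangMills.Theses.ContractibleFibre
open Summit.QuantumFields.YangMills.Cruxes.FibreContinuity.Birth

/-! ## 1–2. The anchor is idle: the crux is the free-b.c. weak-coupling gap -/

/-- **The free-b.c. weak-coupling lattice gap** (the crux's consequent for every `G`, `r`, with the
anchor hypothesis deleted): for every compact simple `G` and faithful unitary `r` (Borel σ-algebra)
there is `β₁` such that for every `β ≥ β₁` ONE rate `m(β) > 0` and, per slab width `w`, ONE constant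
`C(β, w)` cluster the free tubes `(ℤ/L)²×{0..M}²` of EVERY width `M` in time, `L ≥ Lmin(β, M, w)`. -/
def FreeWeakCouplingGap : Prop :=
  ∀ (G : Type) [Group G] [TopologicalSpace G] [IsTopologicalGroup G] [CompactSpace G],
    IsCompactSimpleLieGroup G → letI : MeasurableSpace G := borel G; haveI : BorelSpace G := ⟨rfl⟩;
      ∀ r : LatticeRep G, UniformWidthGap G r

/-- `FreeWeakCouplingGap` gives the crux outright (the hypothesis is simply dropped). -/
theorem fibreContinuity_of_freeGap (h : FreeWeakCouplingGap) : FibreContinuity := by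
  intro G _ _ _ _ hG
  letI : MeasurableSpace G := borel G
  haveI : BorelSpace G := ⟨rfl⟩
  intro r Tube _hA
  exact h G hG r

/-- Given the route's rank-3 crux `FibreAnchor`, the crux gives `FreeWeakCouplingGap`
(modus ponens at each `G`, `r`; the route's `closes` composes the same way). -/
theorem freeGap_of_fibreContinuity (hA : FibreAnchor) (hC : FibreContinuity) :
    FreeWeakCouplingGap := by
  intro G _ _ _ _ hG
  letI : MeasurableSpace G := borel G
  haveI : BorelSpace G := ⟨rfl⟩
  intro r
  exact hC G hG r (hA G hG r)

/-- **The anchor is idle.** Given `FibreAnchor`, the crux `FibreContinuity` is EQUIVALENT to the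
unconditional free-b.c. weak-coupling gap `FreeWeakCouplingGap`. -/
theorem fibreContinuity_iff_freeGap (hA : FibreAnchor) : FibreContinuity ↔ FreeWeakCouplingGap :=
  ⟨freeGap_of_fibreContinuity hA, fibreContinuity_of_freeGap⟩

/-- Hence, given `FibreAnchor`, any hypothesis-free statement implying the crux implies the free gap,
and conversely: lines for the crux are exactly lines for `FreeWeakCouplingGap`. -/
theorem line_for_crux_iff_line_for_freeGap (hA : FibreAnchor) (X : Prop) :
    (X → FibreContinuity) ↔ (X → FreeWeakCouplingGap) :=
  ⟨fun h x => (fibreContinuity_iff_freeGap hA).1 (h x),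
   fun h x => fibreContinuity_of_freeGap (h x)⟩

/-! ## 3. The conclusion dominates the hypothesis in kind (β-dependent rates) -/

/-- `FreeWeakCouplingGap` returns the anchor SHAPE beyond `β₁` at every width, with the rate read off
at `β` (bookkeeping: `Negative.uniformShape_anchorShape` applied to `T := TubeClusters G r`). It does
NOT return `AnchorAt G r` (rate `m₀(M)` uniform in `β`), so `FibreAnchor` is a genuine side
hypothesis of `fibreContinuity_iff_freeGap`, not a consequence. -/
theorem freeGap_anchorShape (h : FreeWeakCouplingGap) :
    ∀ (G : Type) [Group G] [TopologicalSpace G] [IsTopologicalGroup G] [CompactSpace G],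
      IsCompactSimpleLieGroup G → letI : MeasurableSpace G := borel G; haveI : BorelSpace G := ⟨rfl⟩;
        ∀ r : LatticeRep G, ∀ M : ℕ, ∃ β₀ : ℝ, ∀ β : ℝ, β₀ ≤ β → ∃ m₀ : ℝ, 0 < m₀ ∧ ∀ w : ℕ,
          ∃ C : ℝ, ∃ Lmin : ℕ, TubeClusters G r M β m₀ C w Lmin := by
  intro G _ _ _ _ hG
  letI : MeasurableSpace G := borel G
  haveI : BorelSpace G := ⟨rfl⟩
  intro r
  exact Summit.QuantumFields.YangMills.Theorems.FibreContinuity.Negative.uniformShape_anchorShape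
    (fun M β m C w Lmin => TubeClusters G r M β m C w Lmin) (h G hG r)

/-! ## 4. The torus-conditional split, typed — and why it is circular in this route -/

/-- The **torus weak-coupling gap for one `G`, `r`** — verbatim the body of the route's target
`UniformLatticeGap` (stmt-QuantumFields-8778) after its `∀ G … r` prefix. -/
def TorusGapAt (G : Type) [Group G] [TopologicalSpace G] [IsTopologicalGroup G] [CompactSpace G]
    [MeasurableSpace G] [BorelSpace G] (r : LatticeRep G) : Prop :=
  ∃ β₀ : ℝ, ∀ β : ℝ, β₀ ≤ β → ∃ m : ℝ, 0 < m ∧ ∃ S₁ : ℕ, ∀ A B : YMSpecies G, ∃ C : ℝ, ∀ S n : ℕ,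
    S₁ ≤ S → n ≤ S → |latticeConnectedCorr r.ρ β (2 * S + 1) A.F B.F n| ≤ C * Real.exp (-(m * n))

/-- Piece 1 of the split: the torus gap for all `G`, `r` (all Borel structures, as the target states it). -/
def TorusGapAll : Prop :=
  ∀ (G : Type) [Group G] [TopologicalSpace G] [IsTopologicalGroup G] [CompactSpace G]
    [MeasurableSpace G] [BorelSpace G], IsCompactSimpleLieGroup G → ∀ r : LatticeRep G, TorusGapAt G r

/-- Piece 1 IS the route's target item, definitionally. -/
theorem torusGapAll_iff : TorusGapAll ↔ UniformLatticeGap := Iff.rfl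

/-- Piece 2 of the split: **torus ⇒ free tubes** (the `free-end-transfer-flow` idea read as a
decomposition: RP row-transfer operator in a fibre direction, rank-one free-end cut, no wall states on
the free faces). Honest mathematics, but conditional on piece 1. -/
def TorusToTube : Prop :=
  ∀ (G : Type) [Group G] [TopologicalSpace G] [IsTopologicalGroup G] [CompactSpace G],
    IsCompactSimpleLieGroup G → letI : MeasurableSpace G := borel G; haveI : BorelSpace G := ⟨rfl⟩;
      ∀ r : LatticeRep G, TorusGapAt G r → UniformWidthGap G r

/-- The split composes to the crux (glue by modus ponens; the anchor is, again, unused). -/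
theorem fibreContinuity_of_torusSplit (h₁ : TorusGapAll) (h₂ : TorusToTube) : FibreContinuity := by
  refine fibreContinuity_of_freeGap ?_
  intro G _ _ _ _ hG
  letI : MeasurableSpace G := borel G
  haveI : BorelSpace G := ⟨rfl⟩
  intro r
  exact h₂ G hG r (h₁ G hG r)

/-- **Circularity.** Piece 1 together with the route's rank-5 item `WeakCouplingContinuumLeg` already
proves the sub-problem Statement `YangMills` — without `FibreAnchor`, `FibreContinuity`,
`FibreToTorus` or `TorusToTube`. So the split `TorusGapAll → TorusToTube → FibreContinuity` would
make every fibre item of the route leave the cone of `closes`: it is not a redirect of this crux. -/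
theorem yangMills_of_torusGapAll_of_leg (h₁ : TorusGapAll) (hL : WeakCouplingContinuumLeg) :
    YangMills := by
  intro G _ _ _ _ hG
  refine hL G hG fun r => ?_
  letI : MeasurableSpace G := borel G
  haveI : BorelSpace G := ⟨rfl⟩
  exact h₁ G hG r

/-- The same circularity through the route's own deciding theorem: with piece 1 in hand the three
fibre hypotheses of `closes` can be fed ANYTHING-implies conclusions — here we just record that
`closes` factors through `UniformLatticeGap` (its `FibreToTorus` step ends exactly in `TorusGapAt`). -/
theorem torusGapAt_of_fibre (hA : FibreAnchor) (hC : FibreContinuity) (hT : FibreToTorus) :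
    ∀ (G : Type) [Group G] [TopologicalSpace G] [IsTopologicalGroup G] [CompactSpace G],
      IsCompactSimpleLieGroup G → letI : MeasurableSpace G := borel G; haveI : BorelSpace G := ⟨rfl⟩;
        ∀ r : LatticeRep G, TorusGapAt G r := by
  intro G _ _ _ _ hG
  letI : MeasurableSpace G := borel G
  haveI : BorelSpace G := ⟨rfl⟩
  intro r
  exact hT G hG r (hC G hG r (hA G hG r))

end Summit.QuantumFields.YangMills.Cruxes.FibreContinuity.CensusR1

end
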